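import Summits.ResolutionOfSingularities.ResolutionOfSingularities.Theorems.MarkedTransferCampaignW46MohWindowShadePSDigits
import Mathlib.Order.WellFounded
import HarnessLib

/-!
# [OURS · L1 W4.6] Rung (iii) "Moh window", power-series residuals, surfaces — THE SHAPE OF EVERY INFINITE
  IN-WINDOW WALK: a coordinate `p`-th power, or a digit phase following a formal branch (proofs only)

Cell `res-hironaka`, rung L, slot W4.6, seat `res-L1-s46-pv-6` (gen 6).  `--kind proof --supports
stmt-ResolutionOfSingularities-16155 --as helper`.  The walk-level theorems of `…MohWindowShadePhase` (gen 3) for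
walks of SERIES states (`…MohWindowShadePSModel`): the same proofs, every one-step law replaced by its series
twin (`…PSLaws`) and the run formula by `Series.formal_pth_power_of_run_digits` (`…PSDigits`).
`Series.invariants_of_walk` · `Series.phase_of_stall_walk` · `Series.phase_of_walk` · `Series.formal_branch_of_walk`.
OURS; NOT a statement of the manuscript [claim: Hironaka2017, status: under-review], nothing of which is used.
AI review is weaker than expert review.
-/

noncomputable section

set_option linter.dupNamespace false -- mandated namespace of this single-conjunct summit

open MvPolynomial Finset

namespace Summit.ResolutionOfSingularities.ResolutionOfSingularities.Theorems.CampaignW46.MohWindowShadePS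

open Literature.AlgebraicGeometry.Resolution
open Literature.AlgebraicGeometry.Resolution.PointBlowup
open Literature.AlgebraicGeometry.Resolution.Hauser2010
open MohWindowShadeCleaning (eq_single_add_single degree_eq_add)
open MohWindowShadeStallWalk (univ_erase_eq_singleton)

variable {σ : Type*} {K : Type*} [Field K] [Fintype σ] [DecidableEq σ] [DecidableEq K]
variable (p : ℕ) [hp : Fact p.Prime] [CharP K p]

section TwoLetters

variable {j i : σ}

/-! ## §1 Invariants of an in-window series walk -/

/-- **[OURS · L1 W4.6] Invariants along an in-window walk of equimultiple points, series residuals (surfaces).**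
Cleanedness and `y^r ∣ F` persist, and the order is a natural number STRICTLY between `p` and `2p` at every stage
(the bottom edge `ord F = p` carries no equimultiple point).  NOT a statement of the manuscript. [folklore] -/
theorem Series.invariants_of_walk (hij : i ≠ j) (htwo : ∀ l, l = j ∨ l = i) (S : ℕ → Series σ K)
    (c : ℕ → σ) (b : ℕ → σ → K) (hb : ∀ n, b n (c n) = 0)
    (hstep : ∀ n, S (n + 1) = (S n).step p (c n) (b n))
    (hclean : IsClean p (S 0).F) (hr : Divides (S 0).r (S 0).F)
    (heq : ∀ n, (S n).IsEquimultiplePoint p (c n) (b n))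
    (hwin : ∀ n, (p : ℕ∞) ≤ (S n).F.order ∧ (S n).F.order < (2 * p : ℕ)) (n : ℕ) :
    IsClean p (S n).F ∧ Divides (S n).r (S n).F ∧ ∃ o : ℕ, (S n).F.order = o ∧ p < o ∧ o < 2 * p := by
  have hnat : ∀ n, ∃ o : ℕ, (S n).F.order = o ∧ p ≤ o ∧ o < 2 * p := by
    intro n
    obtain ⟨o, ho, ho2⟩ := (S n).exists_order_eq_of_lt (hwin n).2
    exact ⟨o, ho, by have := (hwin n).1; rw [ho] at this; exact_mod_cast this, ho2⟩
  have hinv : ∀ n, IsClean p (S n).F ∧ Divides (S n).r (S n).F := by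
    intro n
    induction n with
    | zero => exact ⟨hclean, hr⟩
    | succ n ih =>
      obtain ⟨o, ho, -, -⟩ := hnat n
      rw [hstep n]
      exact ⟨(S n).isClean_step p (c n) (b n), (S n).divides_step p (c n) (b n) (hb n) ho ih.2⟩
  refine ⟨(hinv n).1, (hinv n).2, ?_⟩
  obtain ⟨o, ho, hpo, ho2⟩ := hnat n
  refine ⟨o, ho, ?_, ho2⟩
  rcases hpo.lt_or_eq with h | h
  · exact h
  · exfalso
    have hordp : (S n).F.order = p := by rw [ho, h]
    rcases htwo (c n) with hc | hc
    · have hbj : b n j = 0 := by rw [← hc]; exact hb n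
      have heq' : (S n).IsEquimultiplePoint p j (b n) := by rw [← hc]; exact heq n
      exact (S n).not_isEquimultiplePoint_of_order_eq p hij htwo (b n) hbj (hinv n).1 hordp heq'
    · have htwo' : ∀ l, l = i ∨ l = j := fun l => (htwo l).symm
      have hbi : b n i = 0 := by rw [← hc]; exact hb n
      have heq' : (S n).IsEquimultiplePoint p i (b n) := by rw [← hc]; exact heq n
      exact (S n).not_isEquimultiplePoint_of_order_eq p hij.symm htwo' (b n) hbi (hinv n).1 hordp heq'

/-! ## §2 The shape of an infinite stall walk -/

/-- **[OURS · L1 W4.6] SURFACES, power-series residuals: THE SHAPE OF AN INFINITE STALL WALK — a coordinate `p`-th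
power, or a DIGIT PHASE** (`…Phase.phase_of_stall_walk` for series states).  Infinite walk
`S_{n+1} = step p (c n) (b n) (S n)` of point blow-ups of `x^p + F(y_j, y_i)`, `F ∈ K⟦y⟧`, in the Hauser–Wagner frame
(`b n (c n) = 0`; `b n = 0` when `c n = i`), cleaned start with `y^r ∣ F`, every step equimultiple, every state in
the window `p ≤ ord F_n < 2p`, no step dropping the shade ⟹ at some stage `n` EITHER every monomial of `F_n` is
divisible by `y_l^p`, OR from `n` on every step is read in the chart `y_j`, `r_i = 0` and the order is constant.
NOT a statement of the manuscript. [folklore] -/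
theorem Series.phase_of_stall_walk (hij : i ≠ j) (htwo : ∀ l, l = j ∨ l = i) (S : ℕ → Series σ K)
    (c : ℕ → σ) (b : ℕ → σ → K) (hb : ∀ n, b n (c n) = 0) (hHW : ∀ n, c n = i → ∀ l, b n l = 0)
    (hstep : ∀ n, S (n + 1) = (S n).step p (c n) (b n))
    (hclean : IsClean p (S 0).F) (hr : Divides (S 0).r (S 0).F)
    (heq : ∀ n, (S n).IsEquimultiplePoint p (c n) (b n))
    (hwin : ∀ n, (p : ℕ∞) ≤ (S n).F.order ∧ (S n).F.order < (2 * p : ℕ))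
    (hstall : ∀ n, ¬ (S n).ShadeDrops p (c n) (b n)) :
    ∃ n, (∃ l, ∀ d : σ →₀ ℕ, MvPowerSeries.coeff d (S n).F ≠ 0 → p ≤ d l) ∨
      ((∀ k, c (n + k) = j) ∧ (∀ k, (S (n + k)).r i = 0) ∧
        (∀ k, (S (n + k)).F.order = (S n).F.order)) := by
  classical
  -- §a invariants
  have hinv := Series.invariants_of_walk p hij htwo S c b hb hstep hclean hr heq hwin
  choose o ho hlo hhi using fun n => (hinv n).2.2
  have hcl : ∀ n, IsClean p (S n).F := fun n => (hinv n).1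
  have hrn : ∀ n, Divides (S n).r (S n).F := fun n => (hinv n).2.1
  have hrle : ∀ n, (S n).r.degree ≤ o n := fun n => (S n).degree_r_le (ho n) (hrn n)
  have hstepj : ∀ n, c n = j → S (n + 1) = (S n).step p j (b n) := fun n h => by rw [hstep n, h]
  have hbj' : ∀ n, c n = j → b n j = 0 := fun n h => by rw [← h]; exact hb n
  have ho' : ∀ n, ((S n).step p (c n) (b n)).F.order = o (n + 1) := fun n => by rw [← hstep n]; exact ho _
  -- §b the constant shade `A`: `o n = |r n| + A`
  have hshade : ∀ n, (S n).shade = ((o n - (S n).r.degree : ℕ) : ℕ∞) :=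
    fun n => (S n).shade_eq_of_order_eq (ho n)
  have hconst : ∀ n, o (n + 1) - (S (n + 1)).r.degree = o n - (S n).r.degree := by
    intro n
    have hle : (S (n + 1)).shade ≤ (S n).shade := by
      rw [hstep n]
      exact (S n).shade_step_le p (c n) (b n) (hb n) (hcl n) (ho n) (hlo n).le (hhi n) (hrn n) (heq n)
        (ho' n) (hhi (n + 1))
    have hge : ¬ (S (n + 1)).shade < (S n).shade := by
      have := hstall n
      unfold Series.ShadeDrops at this
      rwa [← hstep n] at this
    have heq' : (S (n + 1)).shade = (S n).shade := le_antisymm hle (not_lt.mp hge)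
    rw [hshade, hshade] at heq'
    exact_mod_cast heq'
  set A := o 0 - (S 0).r.degree with hA
  have hA' : ∀ n, o n = (S n).r.degree + A := by
    intro n
    induction n with
    | zero => have := hrle 0; omega
    | succ n ih => have := hconst n; have := hrle (n + 1); have := hrle n; omega
  by_cases hA0 : A = 0
  · -- §c shade zero: the terminal case
    by_cases hprop : ∃ l, p ≤ (S 0).r l
    · obtain ⟨l, hl⟩ := hprop
      exact ⟨0, Or.inl ⟨l, fun d hd => le_trans hl (Finsupp.le_def.mp (hr d hd) l)⟩⟩
    · push Not at hprop
      exfalso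
      have hnpc : ∀ k, ∑ l ∈ univ.erase k, (S 0).r l < p := by
        intro k
        rcases htwo k with hk | hk
        · rw [hk, univ_erase_eq_singleton hij htwo, Finset.sum_singleton]; exact hprop i
        · have htwo' : ∀ l, l = i ∨ l = j := fun l => (htwo l).symm
          rw [hk, univ_erase_eq_singleton hij.symm htwo', Finset.sum_singleton]; exact hprop j
      have hordr : (S 0).F.order = ((S 0).r.degree : ℕ) := by rw [ho 0, hA' 0, hA0, add_zero]
      have hlo0 : p < (S 0).r.degree := by have := hlo 0; rw [hA' 0, hA0] at this; omega
      have hhi0 : (S 0).r.degree < 2 * p := by have := hhi 0; rw [hA' 0, hA0] at this; omega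
      have h := Series.length_le_of_noProperCentre p S c b hb hstep hclean hr hordr hlo0 hhi0 hnpc
        (N := (S 0).r.degree) (fun n _ => (hwin n).2) (fun n _ => heq n)
      have := hp.out.pos
      omega
  · -- §d positive shade
    -- a stall in the chart `y_j` makes the next state adapted
    have hadapt : ∀ n, c n = j →
        ∃ E : σ →₀ ℕ, MvPowerSeries.coeff E (S (n + 1)).F ≠ 0 ∧ E.degree = o (n + 1) ∧
          (S (n + 1)).r i < E i := by
      intro n hcn
      have hstalln : ¬ (S n).ShadeDrops p j (b n) := by
        have := hstall n; rw [hcn] at this; exact this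
      have hAn : o n - (S n).r.degree = A := by have := hA' n; omega
      have hoj : ((S n).step p j (b n)).F.order = o (n + 1) := by rw [← hstepj n hcn]; exact ho _
      by_cases hbi : b n i = 0
      · have hb0 : ∀ l, b n l = 0 := fun l => by
          rcases htwo l with rfl | rfl
          · exact hbj' n hcn
          · exact hbi
        obtain ⟨E, hE, hEj, hEi⟩ := (S n).exists_adapted_of_stall_origin p hij htwo (b n) hb0 (hcl n)
          (ho n) (hlo n) (hhi n) (hrn n) hstalln hoj (hhi (n + 1))
        rw [← hstepj n hcn] at hE hEj hEi
        refine ⟨E, hE, ?_, ?_⟩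
        · rw [degree_eq_add hij htwo E, hEj, hEi, hA' (n + 1), degree_eq_add hij htwo (S (n + 1)).r, hAn]
          ring
        · rw [hEi, hAn]; omega
      · have hE := (S n).coeff_step_ne_zero_of_stall_translate p hij htwo (b n) (hbj' n hcn) hbi (ho n)
          (hlo n) (hhi n) (hrn n) hstalln hoj (hhi (n + 1))
        rw [← hstepj n hcn] at hE
        have hr' : (S (n + 1)).r.degree = o n - p := by
          rw [hstepj n hcn, (S n).degree_step_r p hij htwo (b n) (hbj' n hcn) (ho n), if_neg hbi, add_zero]
        have hri' : (S (n + 1)).r i = 0 := by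
          rw [hstepj n hcn, (S n).step_r_apply (hbj' n hcn) (ho n) i, if_neg hbi]
        refine ⟨_, hE, ?_, ?_⟩
        · rw [map_add, Finsupp.degree_single, Finsupp.degree_single, hA' (n + 1), hr', hAn]
        · rw [hri', Finsupp.add_apply, Finsupp.single_eq_of_ne hij, Finsupp.single_eq_same, zero_add, hAn]
          omega
    -- no vertical stall from an adapted state
    have hnoV : ∀ n, (∃ E : σ →₀ ℕ, MvPowerSeries.coeff E (S n).F ≠ 0 ∧ E.degree = o n ∧ (S n).r i < E i) →
        c n = j := by
      rintro n ⟨E, hE, hEdeg, hEi⟩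
      rcases htwo (c n) with h | h
      · exact h
      · exfalso
        have hb0 : b n = 0 := funext (hHW n h)
        have hoi : ((S n).step p i 0).F.order = o (n + 1) := by rw [← hb0, ← h, ← hstep n]; exact ho _
        have hdrop := (S n).shadeDrops_vertical_of_adapted p (i := i) (ho n) (hlo n) (hhi n) (hrn n) hE
          hEdeg hEi hoi (hhi (n + 1))
        apply hstall n
        rw [h, hb0]
        exact hdrop
    -- persistence of the chart `y_j`
    have hpers : ∀ n, c n = j → ∀ k, c (n + k) = j := by
      intro n hcn k
      induction k with
      | zero => rw [add_zero]; exact hcn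
      | succ k ih => exact hnoV (n + k + 1) (hadapt (n + k) ih)
    by_cases hI : ∃ n₁, c n₁ = j
    · obtain ⟨n₁, hn₁⟩ := hI
      have hcj : ∀ n, n₁ ≤ n → c n = j := by
        intro n hn
        obtain ⟨k, rfl⟩ := Nat.exists_eq_add_of_le hn
        exact hpers n₁ hn₁ k
      by_cases hIa : ∃ n₂, n₁ ≤ n₂ ∧ b n₂ i ≠ 0
      · -- §e a translated stall at `n₂`: afterwards `r_i = 0` and `o_{n+1} + p = o_n + A`
        obtain ⟨n₂, hn₁₂, hbn₂⟩ := hIa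
        have hri : ∀ k, (S (n₂ + 1 + k)).r i = 0 := by
          intro k
          induction k with
          | zero =>
            rw [add_zero, hstepj n₂ (hcj n₂ hn₁₂), (S n₂).step_r_apply (hbj' n₂ (hcj n₂ hn₁₂)) (ho n₂) i,
              if_neg hbn₂]
          | succ k ih =>
            have hc' : c (n₂ + 1 + k) = j := hcj _ (by omega)
            rw [show n₂ + 1 + (k + 1) = n₂ + 1 + k + 1 by omega, hstepj _ hc',
              (S _).step_r_apply (hbj' _ hc') (ho _) i, if_neg hij, ih]
            split_ifs <;> rfl
        have hodyn : ∀ k, o (n₂ + 1 + k + 1) + p = o (n₂ + 1 + k) + A := by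
          intro k
          have hc' : c (n₂ + 1 + k) = j := hcj _ (by omega)
          have h1 := hA' (n₂ + 1 + k + 1)
          have h2 : (S (n₂ + 1 + k + 1)).r.degree = o (n₂ + 1 + k) - p := by
            rw [hstepj _ hc', (S _).degree_step_r p hij htwo (b _) (hbj' _ hc') (ho _), hri k]
            split_ifs <;> rfl
          have h3 := hlo (n₂ + 1 + k)
          omega
        rcases Nat.lt_trichotomy A p with hAp | hAp | hAp
        · -- `A < p`: the order decreases for ever
          exfalso
          have hdec : ∀ k, o (n₂ + 1 + k) + k ≤ o (n₂ + 1) := by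
            intro k
            induction k with
            | zero => rw [add_zero, add_zero]
            | succ k ih =>
              have := hodyn k
              rw [show n₂ + 1 + (k + 1) = n₂ + 1 + k + 1 by omega]
              omega
          have := hdec (o (n₂ + 1) + 1)
          omega
        · -- `A = p`: a digit phase
          have hO : ∀ k, o (n₂ + 1 + k) = o (n₂ + 1) := by
            intro k
            induction k with
            | zero => rw [add_zero]
            | succ k ih =>
              have := hodyn k
              rw [show n₂ + 1 + (k + 1) = n₂ + 1 + k + 1 by omega]
              omega
          exact ⟨n₂ + 1, Or.inr ⟨fun k => hcj _ (by omega), hri, fun k => by rw [ho, ho, hO k]⟩⟩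
        · -- `p < A`: the order increases for ever, against the window
          exfalso
          have hinc : ∀ k, o (n₂ + 1) + k ≤ o (n₂ + 1 + k) := by
            intro k
            induction k with
            | zero => rw [add_zero, add_zero]
            | succ k ih =>
              have := hodyn k
              rw [show n₂ + 1 + (k + 1) = n₂ + 1 + k + 1 by omega]
              omega
          have h1 := hinc (2 * p)
          have h2 := hhi (n₂ + 1 + 2 * p)
          omega
      · -- §f no translated move after `n₁`: an origin run in the chart `y_j`
        push Not at hIa
        have hb0 : ∀ n, n₁ ≤ n → b n = 0 := fun n hn => funext fun l => by
          rcases htwo l with rfl | rfl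
          · exact hbj' n (hcj n hn)
          · exact hIa n hn
        have hrun := Series.forall_le_sum_of_origin_run p j (fun k => S (n₁ + k))
          (fun k => by
            show S (n₁ + (k + 1)) = (S (n₁ + k)).step p j 0
            rw [show n₁ + (k + 1) = n₁ + k + 1 by omega, hstep, hcj _ (by omega), hb0 _ (by omega)])
          (hcl n₁) (fun k => ⟨o (n₁ + k), ho _, (hlo _).le⟩)
        refine ⟨n₁, Or.inl ⟨i, fun d hd => ?_⟩⟩
        have := hrun d hd
        rwa [univ_erase_eq_singleton hij htwo, Finset.sum_singleton] at this
    · -- §g every move is vertical: an origin run in the chart `y_i` from the start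
      push Not at hI
      have hci : ∀ n, c n = i := fun n => by
        rcases htwo (c n) with h | h
        · exact absurd h (hI n)
        · exact h
      have hb0 : ∀ n, b n = 0 := fun n => funext (hHW n (hci n))
      have hrun := Series.forall_le_sum_of_origin_run p i S
        (fun n => by rw [hstep n, hci n, hb0 n]) hclean (fun k => ⟨o k, ho _, (hlo _).le⟩)
      refine ⟨0, Or.inl ⟨j, fun d hd => ?_⟩⟩
      have := hrun d hd
      have htwo' : ∀ l, l = i ∨ l = j := fun l => (htwo l).symm
      rwa [univ_erase_eq_singleton hij.symm htwo', Finset.sum_singleton] at this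

/-! ## §3 Every infinite in-window series walk -/

/-- **[OURS · L1 W4.6] SURFACES, power-series residuals: THE SHAPE OF EVERY INFINITE IN-WINDOW WALK — a
coordinate `p`-th power, or a DIGIT PHASE** (`…Phase.phase_of_walk` for series states; the shade is eventually
constant by the no-increase law).  NOT a statement of the manuscript. [folklore] -/
theorem Series.phase_of_walk (hij : i ≠ j) (htwo : ∀ l, l = j ∨ l = i) (S : ℕ → Series σ K)
    (c : ℕ → σ) (b : ℕ → σ → K) (hb : ∀ n, b n (c n) = 0) (hHW : ∀ n, c n = i → ∀ l, b n l = 0)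
    (hstep : ∀ n, S (n + 1) = (S n).step p (c n) (b n))
    (hclean : IsClean p (S 0).F) (hr : Divides (S 0).r (S 0).F)
    (heq : ∀ n, (S n).IsEquimultiplePoint p (c n) (b n))
    (hwin : ∀ n, (p : ℕ∞) ≤ (S n).F.order ∧ (S n).F.order < (2 * p : ℕ)) :
    ∃ n, (∃ l, ∀ d : σ →₀ ℕ, MvPowerSeries.coeff d (S n).F ≠ 0 → p ≤ d l) ∨
      ((∀ k, c (n + k) = j) ∧ (∀ k, (S (n + k)).r i = 0) ∧
        (∀ k, (S (n + k)).F.order = (S n).F.order)) := by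
  classical
  have hinv := Series.invariants_of_walk p hij htwo S c b hb hstep hclean hr heq hwin
  choose o ho hlo hhi using fun n => (hinv n).2.2
  have hcl : ∀ n, IsClean p (S n).F := fun n => (hinv n).1
  have hrn : ∀ n, Divides (S n).r (S n).F := fun n => (hinv n).2.1
  have hshade : ∀ n, (S n).shade = ((o n - (S n).r.degree : ℕ) : ℕ∞) :=
    fun n => (S n).shade_eq_of_order_eq (ho n)
  set a : ℕ → ℕ := fun n => o n - (S n).r.degree with ha
  have hsucc : ∀ n, a (n + 1) ≤ a n := by
    intro n
    have hle : (S (n + 1)).shade ≤ (S n).shade := by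
      rw [hstep n]
      exact (S n).shade_step_le p (c n) (b n) (hb n) (hcl n) (ho n) (hlo n).le (hhi n) (hrn n) (heq n)
        (o' := o (n + 1)) (by rw [← hstep n]; exact ho _) (hhi (n + 1))
    rw [hshade, hshade] at hle
    exact_mod_cast hle
  have hanti : Antitone a := antitone_nat_of_succ_le hsucc
  set n₀ := Function.argmin a with hn₀
  have hmin : ∀ n, a n₀ ≤ a n := fun n => not_lt.mp (Function.not_lt_argmin a n)
  have hstall : ∀ k, ¬ (S (n₀ + k)).ShadeDrops p (c (n₀ + k)) (b (n₀ + k)) := by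
    intro k hdrop
    unfold Series.ShadeDrops at hdrop
    rw [← hstep, hshade, hshade] at hdrop
    have h1 : a (n₀ + k + 1) < a (n₀ + k) := by exact_mod_cast hdrop
    have h2 := hmin (n₀ + k + 1)
    have h3 := hanti (show n₀ ≤ n₀ + k by omega)
    exact absurd (lt_of_lt_of_le h1 h3) (not_lt.mpr h2)
  obtain ⟨n, hn⟩ := Series.phase_of_stall_walk p hij htwo (fun k => S (n₀ + k))
    (fun k => c (n₀ + k)) (fun k => b (n₀ + k)) (fun k => hb (n₀ + k)) (fun k => hHW (n₀ + k))
    (fun k => by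
      show S (n₀ + (k + 1)) = (S (n₀ + k)).step p (c (n₀ + k)) (b (n₀ + k))
      rw [show n₀ + (k + 1) = n₀ + k + 1 by omega]
      exact hstep (n₀ + k))
    (hcl n₀) (hrn n₀) (fun k => heq (n₀ + k)) (fun k => hwin (n₀ + k)) hstall
  refine ⟨n₀ + n, ?_⟩
  rcases hn with h | ⟨h1, h2, h3⟩
  · exact Or.inl h
  · refine Or.inr ⟨fun k => ?_, fun k => ?_, fun k => ?_⟩
    · have := h1 k; rwa [add_assoc]
    · have := h2 k; rwa [add_assoc]
    · have := h3 k; rwa [← add_assoc] at this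

/-- **[OURS · L1 W4.6] SURFACES, power-series residuals: EVERY INFINITE IN-WINDOW WALK FOLLOWS A CANONICAL FORMAL
`p`-FOLD BRANCH** (`…Phase.formal_branch_of_walk` for series states): at some stage `n`, either `y_l^p ∣ F_n`
coefficientwise, or for EVERY `k`, `F_n ≡ (y_i − Σ_{k'<k} t_{n+k'} y_j^{k'+1})^p · w_k` modulo degree `≥ ord F_n + k`,
`t_m = b m i` the later POINTS OF THE WALK.  NOT a statement of the manuscript. [folklore] -/
theorem Series.formal_branch_of_walk (hij : i ≠ j) (htwo : ∀ l, l = j ∨ l = i) (S : ℕ → Series σ K)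
    (c : ℕ → σ) (b : ℕ → σ → K) (hb : ∀ n, b n (c n) = 0) (hHW : ∀ n, c n = i → ∀ l, b n l = 0)
    (hstep : ∀ n, S (n + 1) = (S n).step p (c n) (b n))
    (hclean : IsClean p (S 0).F) (hr : Divides (S 0).r (S 0).F)
    (heq : ∀ n, (S n).IsEquimultiplePoint p (c n) (b n))
    (hwin : ∀ n, (p : ℕ∞) ≤ (S n).F.order ∧ (S n).F.order < (2 * p : ℕ)) :
    ∃ n, (∃ l, ∀ d : σ →₀ ℕ, MvPowerSeries.coeff d (S n).F ≠ 0 → p ≤ d l) ∨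
      ∀ k, ∃ w : MvPolynomial σ K, (S n).F.order + k ≤
        ((S n).F - (((X i - ∑ k' ∈ Finset.range k, C (b (n + k') i) * X j ^ (k' + 1)) ^ p * w :
          MvPolynomial σ K) : MvPowerSeries σ K)).order := by
  classical
  obtain ⟨n, hn⟩ := Series.phase_of_walk p hij htwo S c b hb hHW hstep hclean hr heq hwin
  refine ⟨n, ?_⟩
  rcases hn with h | ⟨hcj, -, hord⟩
  · exact Or.inl h
  · right
    intro k
    have hinv := Series.invariants_of_walk p hij htwo S c b hb hstep hclean hr heq hwin
    obtain ⟨o, ho, hlo, -⟩ := (hinv n).2.2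
    have hbj : ∀ k', b (n + k') j = 0 := fun k' => by have := hb (n + k'); rwa [hcj k'] at this
    obtain ⟨w, hw⟩ := Series.formal_pth_power_of_run_digits p hij htwo (fun k' => S (n + k'))
      (fun k' => b (n + k')) hbj
      (fun k' => by
        show S (n + (k' + 1)) = (S (n + k')).step p j (b (n + k'))
        rw [show n + (k' + 1) = n + k' + 1 by omega, hstep, hcj k'])
      (hinv n).1
      (fun k' => by
        obtain ⟨o', ho', hlo', hhi'⟩ := (hinv (n + k')).2.2
        exact ⟨o', ho', hlo'.le, hhi'⟩)
      k (o := o) (by rw [hord k, ho])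
    refine ⟨w, ?_⟩
    rw [ho]
    exact_mod_cast hw

end TwoLetters

end Summit.ResolutionOfSingularities.ResolutionOfSingularities.Theorems.CampaignW46.MohWindowShadePS
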